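import Summits.BirchSwinnertonDyer.BirchSwinnertonDyer.Theorems.KolyvaginRoadThreeMethod2ChebTarget
import Summits.BirchSwinnertonDyer.BirchSwinnertonDyer.Theorems.AdditiveKolyvaginRoadLocalFrobenius
import HarnessLib

/-!
# Route `AdditiveKolyvaginRoad`, crux `KolyvaginPrimitiveAdditive` (item stmt-BirchSwinnertonDyer-20132):
# stub A1 `stub_rankLoweringAdditive`, input (Cheb) I — the ADMISSIBLE TARGET of the Čebotarev argument at a general
# prime `p ≥ 5`
# (cell `pub/bsd-wall`, lead prover `bsd-wall-akr-p1` g2; `--supports stmt-BirchSwinnertonDyer-20132`, helper;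
# p-generic port of koly g13's `Theorems/KolyvaginRoadThreeMethod2ChebTarget.lean`, unipotent target `ν(1 + N')` ↦
# semisimple target `diag(ν, 2ν)` of a Bertolini–Darmon admissible Frobenius)

WHY THIS FILE. The last input (Cheb) of akr-p1 g0's reduction of stub A1 (`selQP_rankLowering_of_localGlobal`, p511644)
asks: for every non-zero class `x` of an eigen-Selmer space `Sel_n^μ ⊂ H¹(K, E[p])` a NEW Bertolini–Darmon admissible
prime `q ∉ n` with `loc_v x ≠ 0` at the place `v ∣ q` of `K` (W. Zhang 2014 Lemma 7.3 ∕ Bertolini–Darmon 2005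
Thm. 3.2, with the sign rule `ε_q = μ`). This file prepares the Čebotarev argument of the next file
(`AdditiveKolyvaginRoadCheb`):

* §1 `trace_det_of_quadratic` — linear algebra on a plane: `f² = a f − b`, `f` non-scalar force `tr f = a`, `det f = b`
  (Cayley–Hamilton).
* §2 `exists_prime_dvd_discr_not_dvd` — on the frame (`K` imaginary quadratic, `p ∣ N_E`, Heegner hypothesis for
  `N_E`) some prime `q₀ ∣ d_K` has `q₀ ∤ N_E`, `q₀ ≠ p` (split primes are unramified; `p ∣ N_E` splits).
* §3 `exists_admissible_target` — the TARGET: `g₁ ∈ Γ_K` and an additive frame `e : E(K̄)[p] ≃ 𝔽_p²` with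
  `e (T (g₁ Q)) = D (e Q)` for `D = diag(ν, 2ν)` (`T` = the involution of `E(K̄)[p]` induced by the lift `t = e c₀ e⁻¹`
  of complex conjugation, `ν = ±1` the prescribed sign) and `c₀ · res g₁` acting on `E(ℚ̄)[p] ≃ E(K̄)[p]` as `D`.
  Ingredients: surjectivity of `ρ̄_{E,p}` on `Γ_ℚ` (`HasSurjectiveModNGaloisRep`) and Gross's disjointness
  `K ∩ ℚ(E[p]) = ℚ` in the form `exists_absGaloisRestrict_smul_eq` (seat shim3b) at the ramified prime `q₀` of §2.
  (`2 ≢ 0, ±1 (mod p)` needs `p ≥ 5`: this is where W. Zhang's `p ≥ 5` enters (Cheb).)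
* §4 `isAdmissible_congruences_of_frob` — if an arithmetic Frobenius above a good prime `ℓ ≠ p` acts on `E(ℚ̄)[p]`, read
  through an additive isomorphism with `𝔽_p²`, as `diag(ν, 2ν)`, then `p ∤ ℓ² − 1` and `p ∣ ℓ + 1 − a_ℓ` (`ν = 1`) resp.
  `p ∣ ℓ + 1 + a_ℓ` (`ν = −1`): `det = ℓ ≡ 2`, `tr = a_ℓ ≡ 3ν` on `E[p]` (tree `det_galoisRepTorsion_frobenius_eq`,
  `trace_galoisRepTorsion_frobenius_eq`, and §1) — the two congruence clauses of `BertoliniDarmon2005.IsAdmissiblePrime`.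

HONEST FRAMING: theorems only; no definition, no named fact, no `sorry`; (Cheb) is NOT proved here (sibling file);
nothing about Heegner points or the crux is asserted; nothing is booked.

References: [cite: WZhang2014, Lemma 7.3, Notations (xiv)] [cite: BertoliniDarmon2005, Thm. 3.2, p. 18]
[cite: GrossLMS1991, §9 Prop. 9.1, 9.3] [cite: Serre1981, §8.1 eq. (238)] [cite: DarmonDiamondTaylor1995, Prop. 2.8 (a)].
-/

-- single-conjunct summit: `Summit.BirchSwinnertonDyer.BirchSwinnertonDyer.…` repeats the name by design
set_option linter.dupNamespace false

noncomputable section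

open scoped Classical Pointwise
open Polynomial

namespace Summit.BirchSwinnertonDyer.BirchSwinnertonDyer.Theorems.AdditiveKoly.Cheb

open WeierstrassCurve Field Function NumberField IsDedekindDomain Rat.HeightOneSpectrum
open Literature.NumberTheory.EllipticCurves Literature.NumberTheory.GaloisRepresentations Module
open Summit.BirchSwinnertonDyer.Rank1Residual.X11b.Three.Koly.Method2

/-! ## §1 Linear algebra: trace and determinant from a quadratic relation -/

section Plane

variable {k : Type*} [Field k] {V : Type*} [AddCommGroup V] [Module k V] [FiniteDimensional k V]

/-- On a `2`-dimensional space the characteristic polynomial of an endomorphism `f` is `X² − tr(f) X + det(f)`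
(a copy of koly g13's private lemma). [folklore] -/
private theorem charpoly_eq_of_finrank_eq_two'' (h2 : Module.finrank k V = 2) (f : Module.End k V) :
    f.charpoly = X ^ 2 - C (LinearMap.trace k V f) * X + C (LinearMap.det f) := by
  let b := Module.finBasisOfFinrankEq k V h2
  rw [← LinearMap.charpoly_toMatrix f b, Matrix.charpoly_fin_two,
    ← LinearMap.trace_eq_matrix_trace k b f, LinearMap.det_toMatrix b f]

/-- Cayley–Hamilton in dimension `2`, pointwise. [folklore] -/
private theorem apply_apply_eq_of_finrank_eq_two'' (h2 : Module.finrank k V = 2) (f : Module.End k V) (x : V) :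
    f (f x) = LinearMap.trace k V f • f x - LinearMap.det f • x := by
  have hCH := LinearMap.aeval_self_charpoly f
  rw [charpoly_eq_of_finrank_eq_two'' h2, map_add, map_sub, map_mul, aeval_C, aeval_C, map_pow, aeval_X] at hCH
  have h := congrArg (fun g : Module.End k V => g x) hCH
  simp only [LinearMap.add_apply, LinearMap.sub_apply, LinearMap.zero_apply, Module.End.mul_apply,
    pow_two, Module.algebraMap_end_apply] at h
  rw [sub_add_eq_add_sub, sub_eq_zero] at h
  rw [eq_sub_iff_add_eq]
  rw [← h]

/-- **Trace and determinant from a quadratic relation on a plane.** If `f (f x) = a • f x − b • x` for all `x` and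
`f` is not a scalar, then `tr f = a` and `det f = b` (Cayley–Hamilton: `(a − tr f) f = (b − det f) · 1`, and a
non-scalar `f` forces both coefficients to vanish). [folklore] -/
theorem trace_det_of_quadratic (h2 : Module.finrank k V = 2) (f : Module.End k V) (a b : k)
    (hf : ∀ x, f (f x) = a • f x - b • x) (hne : ∀ c : k, ∃ x, f x ≠ c • x) :
    LinearMap.trace k V f = a ∧ LinearMap.det f = b := by
  have hrel : ∀ x, (a - LinearMap.trace k V f) • f x = (b - LinearMap.det f) • x := fun x ↦ by
    have h1 := hf x
    rw [apply_apply_eq_of_finrank_eq_two'' h2 f x] at h1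
    rw [sub_smul, sub_smul]
    exact sub_eq_sub_iff_sub_eq_sub.mp h1.symm
  by_cases htr : LinearMap.trace k V f = a
  · refine ⟨htr, ?_⟩
    haveI : Nontrivial V := Module.nontrivial_of_finrank_pos (R := k) (by rw [h2]; norm_num)
    obtain ⟨x, hx⟩ := exists_ne (0 : V)
    have h := hrel x
    rw [htr, sub_self, zero_smul] at h
    by_contra hdet
    exact hx (smul_eq_zero.mp h.symm |>.resolve_left (sub_ne_zero.mpr (Ne.symm hdet)))
  · exfalso
    have hne0 : a - LinearMap.trace k V f ≠ 0 := sub_ne_zero.mpr (Ne.symm htr)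
    obtain ⟨x, hx⟩ := hne ((a - LinearMap.trace k V f)⁻¹ * (b - LinearMap.det f))
    apply hx
    rw [mul_smul, ← hrel x, smul_smul, inv_mul_cancel₀ hne0, one_smul]

end Plane

/-! ## §2 A ramified prime away from `p N_E` -/

section Ramified

variable (W : WeierstrassCurve ℚ) (K : Type) [Field K] [NumberField K] [W.IsElliptic]

omit [W.IsElliptic] in
/-- **A ramified prime away from `p N_E`.** For `K` imaginary quadratic, `E = W/ℚ` with `p ∣ N_E` (e.g. additive
reduction at `p`) and `N_E` satisfying the Heegner hypothesis in `K`, some prime `q ∣ d_K` divides neither `N_E` nor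
`p`: primes dividing `N_E` split in `K` (`SatisfiesHeegnerHypothesis.not_dvd_discr`), in particular `p`, while `q`
ramifies. Port of koly g13's `exists_prime_dvd_discr_not_dvd_three`. [cite: GrossLMS1991, §9 (PDF p. 227)] -/
theorem exists_prime_dvd_discr_not_dvd (hK : IsImaginaryQuadratic K) {p : ℕ} (hp : p.Prime)
    (hpN : p ∣ W.conductorNorm ℤ) (hH : SatisfiesHeegnerHypothesis (W.conductorNorm ℤ) K) :
    ∃ q : ℕ, q.Prime ∧ (q : ℤ) ∣ NumberField.discr K ∧ ¬ q ∣ W.conductorNorm ℤ ∧ ¬ (q : ℤ) ∣ ((p : ℕ) : ℤ) := by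
  obtain ⟨q, hq, hqd⟩ := ShimuraKolyvaginImageDisjoint.exists_prime_dvd_discr K (by rw [hK.1]; exact one_lt_two)
  have hqN : ¬ q ∣ W.conductorNorm ℤ := fun h ↦
    Literature.SatisfiesHeegnerHypothesis.not_dvd_discr hK.1 hH hq h hqd
  have hqp : q ≠ p := by rintro rfl; exact hqN hpN
  refine ⟨q, hq, hqd, hqN, fun h ↦ hqp ?_⟩
  have h' : q ∣ p := by exact_mod_cast h
  exact (Nat.prime_dvd_prime_iff_eq hq hp).mp h'

end Ramified

/-! ## §3 The admissible target: `g₁ ∈ Γ_K` with `c₀ · res g₁` acting on `E[p]` as `diag(ν, 2ν)` -/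

section Target

variable (W : WeierstrassCurve ℚ) (K : Type) [Field K] [NumberField K] [W.IsElliptic] [W.IsGloballyMinimal]

/-- `2 ≠ 0` and `2 · 2⁻¹ = 1` in `𝔽_p` for an odd prime `p`. [folklore] -/
private theorem two_ne_zero_zmod {p : ℕ} [Fact p.Prime] (h5 : 5 ≤ p) : (2 : ZMod p) ≠ 0 := by
  intro h
  have : (p : ℕ) ∣ 2 := by
    have h' : ((2 : ℕ) : ZMod p) = 0 := by exact_mod_cast h
    exact (ZMod.natCast_eq_zero_iff 2 p).mp h'
  have := Nat.le_of_dvd (by norm_num) this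
  omega

omit [W.IsGloballyMinimal] in
/-- **The admissible target of the Čebotarev argument.** On the frame (`K` imaginary quadratic, `ρ̄_{E,p}` onto,
`p ∣ N_E`, Heegner hypothesis, `p ≥ 5`), for the lift `t = e c₀ e⁻¹` of the complex conjugation `c` of `K`
(`IsLiftOfAut c t`, `t² = 1`) and a sign `ν = ±1`, there are `g₁ ∈ Γ_K` and an additive frame
`e : E(K̄)[p] ≃ 𝔽_p²` with `e (T (g₁ Q)) = D (e Q)` for all `Q`, `D(v₀, v₁) = (ν v₀, 2ν v₁)` (`T` the involution of
`E(K̄)[p]` induced by `t`), and `c₀ · res(g₁)` acting on `E(ℚ̄)[p]`, read in `E(K̄)[p]` through `RatClosure.torsionEquiv`,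
as `D`. Construction: the automorphism `θ⁻¹ T (e⁻¹ D e) θ` of `E(ℚ̄)[p]` is `ρ̄(γ_M)` for some `γ_M ∈ Γ_ℚ` (surjectivity),
and `γ_M` acts on `E[p]` as some `res g₁`, `g₁ ∈ Γ_K` (Gross's disjointness at a ramified prime `q₀ ∤ pN_E`,
`ShimuraKolyvaginImageDisjoint.exists_absGaloisRestrict_smul_eq`). Port of koly g13's `exists_unipotent_target`.
[cite: GrossLMS1991, §9 (PDF p. 227)] [cite: WZhang2014, Lemma 7.3 (proof)] [cite: BertoliniDarmon2005, Thm. 3.2] -/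
theorem exists_admissible_target {p : ℕ} [Fact p.Prime] (h5 : 5 ≤ p) (hK : IsImaginaryQuadratic K)
    (hsurj : W.HasSurjectiveModNGaloisRep p)
    (hpN : p ∣ W.conductorNorm ℤ) (hH : SatisfiesHeegnerHypothesis (W.conductorNorm ℤ) K)
    {c : K ≃ₐ[ℚ] K} {c₀ : absoluteGaloisGroup ℚ}
    (ht : IsLiftOfAut c (absGaloisTransport (K := ℚ) (L := K) c₀).toRingEquiv)
    (hinv : ∀ x, (absGaloisTransport (K := ℚ) (L := K) c₀).toRingEquiv
      ((absGaloisTransport (K := ℚ) (L := K) c₀).toRingEquiv x) = x)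
    {ν : ℤ} (hν : ν = 1 ∨ ν = -1) :
    ∃ (g₁ : absoluteGaloisGroup K) (e : geomTorsion (W.baseChange K) (p : ℤ) ≃+ (Fin 2 → ZMod p)),
      (∀ Q, e (ht.torsionMap W (p : ℤ) (g₁ • Q)) = ![(ν : ZMod p) * e Q 0, (ν : ZMod p) * 2 * e Q 1]) ∧
      (∀ P : geomTorsion W (p : ℤ),
        e (RatClosure.torsionEquiv (K := K) W (p : ℤ) ((c₀ * absGaloisRestrict ℚ K g₁) • P)) =
          ![(ν : ZMod p) * e (RatClosure.torsionEquiv (K := K) W (p : ℤ) P) 0,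
            (ν : ZMod p) * 2 * e (RatClosure.torsionEquiv (K := K) W (p : ℤ) P) 1]) := by
  have hp : p.Prime := Fact.out
  set n : ℤ := (p : ℤ) with hn
  have hνν : ν * ν = 1 := by rcases hν with rfl | rfl <;> norm_num
  have hννk : (ν : ZMod p) * (ν : ZMod p) = 1 := by rw [← Int.cast_mul, hνν, Int.cast_one]
  have h2 : (2 : ZMod p) ≠ 0 := two_ne_zero_zmod h5
  -- ### `E(K̄)[p] ≃ (ℤ/p)²`
  have hTp : ∀ P : geomTorsion (W.baseChange K) n, p • P = 0 := fun P ↦ by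
    have := (mem_geomTorsion_iff (W.baseChange K) n _).mp P.2
    apply Subtype.ext
    rw [AddSubgroupClass.coe_nsmul, ← natCast_zsmul]
    exact this
  have hcard : Nat.card (geomTorsion (W.baseChange K) n) = p ^ 2 :=
    card_torsionPoints_eq_sq_holds (W.baseChange K) (AlgebraicClosure K) (n := p) (by exact_mod_cast hp.ne_zero)
  obtain ⟨eT⟩ := KolyvaginImage.nonempty_addEquiv_of_card_eq_sq (p := p) hTp hcard
  -- ### `D = diag(ν, 2ν)` as an additive automorphism of `𝔽_p²`
  set D : (Fin 2 → ZMod p) ≃+ (Fin 2 → ZMod p) :=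
    { toFun := fun v ↦ ![(ν : ZMod p) * v 0, (ν : ZMod p) * 2 * v 1]
      invFun := fun v ↦ ![(ν : ZMod p) * v 0, (ν : ZMod p) * 2⁻¹ * v 1]
      left_inv := fun v ↦ by
        ext i
        fin_cases i
        · simp only [Fin.zero_eta, Fin.isValue, Matrix.cons_val_zero]
          rw [← mul_assoc, hννk, one_mul]
        · simp only [Fin.mk_one, Fin.isValue, Matrix.cons_val_one, Matrix.cons_val_zero]
          have : (ν : ZMod p) * 2⁻¹ * ((ν : ZMod p) * 2 * v 1) =
              ((ν : ZMod p) * (ν : ZMod p)) * (2⁻¹ * 2) * v 1 := by ring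
          rw [this, hννk, inv_mul_cancel₀ h2, one_mul, one_mul]
      right_inv := fun v ↦ by
        ext i
        fin_cases i
        · simp only [Fin.zero_eta, Fin.isValue, Matrix.cons_val_zero]
          rw [← mul_assoc, hννk, one_mul]
        · simp only [Fin.mk_one, Fin.isValue, Matrix.cons_val_one, Matrix.cons_val_zero]
          have : (ν : ZMod p) * 2 * ((ν : ZMod p) * 2⁻¹ * v 1) =
              ((ν : ZMod p) * (ν : ZMod p)) * (2 * 2⁻¹) * v 1 := by ring
          rw [this, hννk, mul_inv_cancel₀ h2, one_mul, one_mul]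
      map_add' := fun a b ↦ by
        ext i
        fin_cases i
        · simp only [Fin.zero_eta, Fin.isValue, Matrix.cons_val_zero, Pi.add_apply]; ring
        · simp only [Fin.mk_one, Fin.isValue, Matrix.cons_val_one, Matrix.cons_val_zero, Pi.add_apply]; ring }
    with hD
  have hDapply : ∀ v, D v = ![(ν : ZMod p) * v 0, (ν : ZMod p) * 2 * v 1] := fun v ↦ rfl
  -- `A = e⁻¹ D e` on `E(K̄)[p]`
  set A : geomTorsion (W.baseChange K) n ≃+ geomTorsion (W.baseChange K) n := eT.trans (D.trans eT.symm) with hA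
  have hAapply : ∀ Q, eT (A Q) = D (eT Q) := fun Q ↦ by
    rw [hA, AddEquiv.trans_apply, AddEquiv.trans_apply, AddEquiv.apply_symm_apply]
  -- ### the involution `T` of `E(K̄)[p]` induced by the lift of `c`, as an additive equivalence
  have hTT : ∀ Q, ht.torsionMap W n (ht.torsionMap W n Q) = Q := ht.torsionMap_torsionMap W hinv n
  set Teq : geomTorsion (W.baseChange K) n ≃+ geomTorsion (W.baseChange K) n :=
    { toFun := ht.torsionMap W n, invFun := ht.torsionMap W n, left_inv := hTT, right_inv := hTT,
      map_add' := fun a b ↦ map_add _ a b }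
    with hTeq
  -- ### `γ_M ∈ Γ_ℚ` acting on `E(ℚ̄)[p]` as `θ⁻¹ T A θ` (surjectivity of `ρ̄_{E,p}`)
  set θ := RatClosure.torsionEquiv (K := K) W n with hθ
  set A₀ : geomTorsion W n ≃+ geomTorsion W n := θ.trans ((A.trans Teq).trans θ.symm) with hA₀
  have hA₀apply : ∀ P, A₀ P = θ.symm (ht.torsionMap W n (A (θ P))) := fun P ↦ rfl
  have hsurj' : Function.Surjective (galoisRepTorsion W n) := hsurj
  obtain ⟨γM, hγM⟩ := hsurj' (Multiplicative.ofAdd A₀)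
  have hγM' : ∀ P : geomTorsion W n, γM • P = A₀ P := fun P ↦ by
    rw [← galoisRepTorsion_apply, hγM]; rfl
  -- ### `g₁ ∈ Γ_K` acting on `E(ℚ̄)[p]` as `γ_M` (Gross's disjointness at a ramified prime)
  obtain ⟨q₀, hq₀, hq₀d, hq₀N, hq₀p⟩ := exists_prime_dvd_discr_not_dvd W K hK hp hpN hH
  obtain ⟨g₁, hg₁⟩ :=
    ShimuraKolyvaginImageDisjoint.exists_absGaloisRestrict_smul_eq W K hK.1 hq₀ hq₀d hq₀N hq₀p γM
  have hG : ∀ Q, ht.torsionMap W n (g₁ • Q) = A Q := fun Q ↦ by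
    obtain ⟨P, rfl⟩ := θ.surjective Q
    rw [← RatClosure.torsionEquiv_smul, hg₁, hγM', hA₀apply, ← hθ, θ.apply_symm_apply, hTT]
  refine ⟨g₁, eT, fun Q ↦ ?_, fun P ↦ ?_⟩
  · rw [hG, hAapply, hDapply]
  · rw [mul_smul, RatClosure.torsionEquiv_smul_of_lift W ht c₀ (fun _ ↦ rfl) n, ← hθ, RatClosure.torsionEquiv_smul,
      hG, hAapply, hDapply]

end Target

/-! ## §4 The prime below a Frobenius of the target shape satisfies the admissibility congruences -/

section Admissible

variable (W : WeierstrassCurve ℚ) [W.IsElliptic] [W.IsGloballyMinimal]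

/-- **The prime below a Frobenius of the target shape satisfies the two congruences of `IsAdmissiblePrime`.** If
`γ ∈ Γ_ℚ` is an arithmetic Frobenius at a prime above the good prime `ℓ ≠ p` of `E = W/ℚ` (global minimal form) and acts
on `E(ℚ̄)[p]`, read through an additive isomorphism `e` with `𝔽_p²`, as `D = diag(ν, 2ν)` (`ν = ±1`, `p ≥ 5`), then
`p ∤ ℓ² − 1` and `p ∣ ℓ + 1 − a_ℓ` (`ν = 1`) resp. `p ∣ ℓ + 1 + a_ℓ` (`ν = −1`): on the `𝔽_p`-plane `E[p]`,
`det ρ̄(γ) = ℓ` and `tr ρ̄(γ) = a_ℓ` (`det_galoisRepTorsion_frobenius_eq`, `trace_galoisRepTorsion_frobenius_eq`), while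
`ρ̄(γ)² = 3ν ρ̄(γ) − 2` with `ρ̄(γ)` non-scalar gives `det = 2`, `tr = 3ν` (§1). Port of koly g13's
`mod_three_and_trace_of_frob`. [cite: Serre1981, §8.1 eq. (238)] [cite: DarmonDiamondTaylor1995, Prop. 2.8 (a)]
[cite: BertoliniDarmon2005, p. 18] -/
theorem isAdmissible_congruences_of_frob {p : ℕ} [Fact p.Prime] (h5 : 5 ≤ p) {ℓ : ℕ} [Fact ℓ.Prime] (hℓp : ℓ ≠ p)
    (hgood : W.HasGoodReductionAtPrime ℓ) {v : HeightOneSpectrum (𝓞 ℚ)} (hv : (primesEquiv v : ℕ) = ℓ)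
    {𝔓 : Ideal (absIntegers (𝓞 ℚ) ℚ)} (h𝔓 : 𝔓 ∈ v.primesAbove)
    {γ : absoluteGaloisGroup ℚ} (hγ : IsArithFrobAt (𝓞 ℚ) γ 𝔓)
    (e : geomTorsion W (p : ℤ) ≃+ (Fin 2 → ZMod p)) {ν : ℤ} (hν : ν = 1 ∨ ν = -1)
    (hact : ∀ P, e (γ • P) = ![(ν : ZMod p) * e P 0, (ν : ZMod p) * 2 * e P 1]) :
    ¬ ((p : ℤ) ∣ (ℓ : ℤ) ^ 2 - 1) ∧
      ((p : ℤ) ^ 1 ∣ (ℓ : ℤ) + 1 - W.frobeniusTrace ℓ ∨ (p : ℤ) ^ 1 ∣ (ℓ : ℤ) + 1 + W.frobeniusTrace ℓ) := by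
  have hp : p.Prime := Fact.out
  letI : Module (ZMod p) (geomTorsion W (p : ℤ)) := AddSubgroup.torsionBy.zmodModule
  set f := (galoisRepTorsion W p γ).toAdd.toAddMonoidHom.toZModLinearMap p with hfdef
  have hf : ∀ Q : geomTorsion W (p : ℤ), f Q = γ • Q := fun Q => rfl
  have htr : LinearMap.trace (ZMod p) _ f = (W.frobeniusTrace ℓ : ZMod p) :=
    W.trace_galoisRepTorsion_frobenius_eq p hℓp hgood hv h𝔓 hγ
  have hdet : LinearMap.det f = (ℓ : ZMod p) := W.det_galoisRepTorsion_frobenius_eq p hℓp hgood hv h𝔓 hγ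
  have h2 : Module.finrank (ZMod p) (geomTorsion W (p : ℤ)) = 2 :=
    Literature.RepresentationTheory.FiniteGroups.Representation.finrank_eq_two_of_natCard_eq_sq
      (card_torsionPoints_eq_sq_holds W (AlgebraicClosure ℚ) (n := p) (by exact_mod_cast hp.ne_zero))
  haveI : FiniteDimensional (ZMod p) (geomTorsion W (p : ℤ)) := Module.finite_of_finrank_eq_succ h2
  have hννk : (ν : ZMod p) * (ν : ZMod p) = 1 := by
    have hνν : ν * ν = 1 := by rcases hν with rfl | rfl <;> norm_num
    rw [← Int.cast_mul, hνν, Int.cast_one]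
  have htwo : (2 : ZMod p) ≠ 0 := two_ne_zero_zmod h5
  -- the linear equivalence `eL : E[p] ≃ₗ 𝔽_p²` underlying `e` (a `ℤ/p`-additive map is linear)
  set eL : geomTorsion W (p : ℤ) →ₗ[ZMod p] (Fin 2 → ZMod p) := e.toAddMonoidHom.toZModLinearMap p with heL
  have heL' : ∀ Q, eL Q = e Q := fun Q ↦ rfl
  -- `f² = 3ν f − 2` on `E[p]`, read through `e`
  have hsq : ∀ Q, f (f Q) = ((3 : ZMod p) * (ν : ZMod p)) • f Q - (2 : ZMod p) • Q := fun Q ↦ by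
    apply e.injective
    have hlin : ∀ (c : ZMod p) (R : geomTorsion W (p : ℤ)), e (c • R) = c • e R := fun c R ↦ by
      rw [← heL', map_smul, heL']
    rw [hf, hf, hact, hact, map_sub, hlin, hlin, hact]
    ext i
    fin_cases i
    · simp only [Fin.zero_eta, Fin.isValue, Matrix.cons_val_zero, Pi.sub_apply, Pi.smul_apply, smul_eq_mul]
      linear_combination (-2 * e Q 0) * hννk
    · simp only [Fin.mk_one, Fin.isValue, Matrix.cons_val_one, Matrix.cons_val_zero, Pi.sub_apply, Pi.smul_apply,
        smul_eq_mul]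
      linear_combination (-2 * e Q 1) * hννk
  -- `f` is not a scalar: `f e⁻¹(1,0) = ν e⁻¹(1,0)` and `f e⁻¹(0,1) = 2ν e⁻¹(0,1)`, `ν ≠ 2ν`
  have hne : ∀ c : ZMod p, ∃ Q, f Q ≠ c • Q := by
    intro c
    by_contra hall
    push Not at hall
    have h0 := congrArg (fun v ↦ v 0) (congrArg e (hall (e.symm ![1, 0])))
    have h1 := congrArg (fun v ↦ v 1) (congrArg e (hall (e.symm ![0, 1])))
    simp only [hf, hact, ← heL', map_smul] at h0 h1
    simp only [heL', AddEquiv.apply_symm_apply, Matrix.cons_val_zero, Matrix.cons_val_one, Pi.smul_apply,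
      smul_eq_mul, mul_one, mul_zero] at h0 h1
    -- `ν = c` and `2ν = c`
    rw [← h0] at h1
    have : (ν : ZMod p) * 2 - (ν : ZMod p) = 0 := by rw [h1, sub_self]
    have hν0 : (ν : ZMod p) ≠ 0 := fun h ↦ by rw [h, zero_mul] at hννk; exact zero_ne_one hννk
    have h3 : (ν : ZMod p) * (2 - 1) = 0 := by rw [mul_sub, mul_one]; exact this
    rcases mul_eq_zero.mp h3 with h4 | h4
    · exact hν0 h4
    · exact one_ne_zero (by linear_combination h4 : (1 : ZMod p) = 0)
  obtain ⟨htr', hdet'⟩ := trace_det_of_quadratic h2 f _ _ hsq hne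
  -- `ℓ ≡ 2`, `a_ℓ ≡ 3ν`
  have hℓ2 : (ℓ : ZMod p) = 2 := hdet.symm.trans hdet'
  have ha3 : (W.frobeniusTrace ℓ : ZMod p) = 3 * (ν : ZMod p) := htr.symm.trans htr'
  constructor
  · -- `ℓ² − 1 ≡ 3 ≢ 0`
    intro hdvd
    have h0 : (((ℓ : ℤ) ^ 2 - 1 : ℤ) : ZMod p) = 0 := (ZMod.intCast_zmod_eq_zero_iff_dvd _ p).mpr hdvd
    push_cast at h0
    rw [hℓ2] at h0
    have h3 : ((3 : ℕ) : ZMod p) = 0 := by norm_num at h0 ⊢; exact h0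
    have := (ZMod.natCast_eq_zero_iff 3 p).mp h3
    have := Nat.le_of_dvd (by norm_num) this
    omega
  · rcases hν with rfl | rfl
    · left
      rw [pow_one]
      apply (ZMod.intCast_zmod_eq_zero_iff_dvd _ p).mp
      push_cast
      rw [hℓ2, ha3]; push_cast; ring
    · right
      rw [pow_one]
      apply (ZMod.intCast_zmod_eq_zero_iff_dvd _ p).mp
      push_cast
      rw [hℓ2, ha3]; push_cast; ring

end Admissible

end Summit.BirchSwinnertonDyer.BirchSwinnertonDyer.Theorems.AdditiveKoly.Cheb

end
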